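import Literature.RingTheory.FormalGroups.LazardComparisonLemma
import Mathlib.RingTheory.Ideal.Span
import Mathlib.RingTheory.Nilpotent.Defs
import Mathlib.RingTheory.Coprime.Lemmas
import Mathlib.Tactic.LinearCombination
import Mathlib.Tactic.Push
import HarnessLib

/-!
# Lazard's comparison lemma (symmetric 2-cocycle lemma), II: coefficient form over rings in which `p` is nilpotent
# ([Lazard 1955] Lemme 3 and its proof §III)

Topic `Literature/RingTheory/FormalGroups`; namespace `Literature.RingTheory.FormalGroups`.  THEOREMS ONLY; no definition,
no named fact, no instance, no `sorry`.  Sequel of `LazardComparisonLemma.lean` (the arithmetic: `cocycleGcd n = d_n`,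
`lazardCoeff n s = b_{n,s} = C(n,s)/d_n`, `lazardIndex p n = s₀`, block Lucas).

LAZARD'S COMPARISON LEMMA (Lemme 3): over any commutative ring, a homogeneous degree-`n` symmetric 2-cocycle
`Σ_{0<s<n} a_s X^s Y^{n-s}` (`a_{n-s} = a_s`, `C(s,i)·a_s = C(n-i,s-i)·a_i` for `1 ≤ i ≤ s ≤ n-1`) is `c · C_n(X,Y)`,
`C_n = Σ b_{n,s} X^s Y^{n-s} = d_n⁻¹((X+Y)^n - X^n - Y^n)`.  Proved here for the rings of the `p`-typical theory —
commutative rings in which a prime `p` is NILPOTENT — along Lazard's own route (§III): first UNIQUENESS over `𝔽_p`-modules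
(stated modulo an ideal `I`, for families killed by `p` modulo `I`): the relations with `i = p^j` and Lucas' theorem force
`a_s ∈ I` for all `s` once `a_{s₀} ∈ I`; then EXISTENCE by the `p`-adic filtration `B ⊇ pB ⊇ … ⊇ p^N B = 0`, correcting by
`b · (u a_{s₀})` (`u` an inverse of `b_{n,s₀}` mod `p`) at each step.

* `cocycleCoeff_mem_of_digit_ne_zero`, `cocycleCoeff_mem_of_lazardIndex_mem` — uniqueness modulo `I`.
* `exists_sub_lazardCoeff_mul_mem` — one filtration step.
* `exists_eq_lazardCoeff_mul_of_isNilpotent` — **the comparison lemma** over `B` with `p` nilpotent: `a_s = b_{n,s} · c`.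

## References
* [Lazard1955] M. Lazard, *Sur les groupes de Lie formels à un paramètre*, Bull. SMF 83 (1955), Lemme 3 (p. 257), proof
  §III (pp. 261–264), relations (3.4)–(3.8), cases 1°–2° over `𝔽_p`.
* [Frohlich1968] A. Fröhlich, *Formal Groups*, LNM 74 (1968), Ch. III §1.

## Design notes
Coefficient families are `a : ℕ → R`; only the indices `1 ≤ s ≤ n-1` matter and all hypotheses are stated on that range.
The polynomial dictionary (`C_n`, the coboundary `δΓ`) is left to the consumer (the bud-obstruction lemma of the `p`-typical
universality theorem).  Lazard's lemma over an arbitrary ring (via `ℚ` and all `𝔽_ℓ`) is not needed there and not proved here.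
-/

namespace Literature.RingTheory.FormalGroups

open Nat Finset

/-! ## §3 Uniqueness over `𝔽_p`-modules (modulo an ideal): Lazard's §III, 1°–2° -/

section Uniqueness

variable {R : Type*} [CommRing R] {p : ℕ} [hp : Fact p.Prime]

omit hp in
/-- If `m·x ∈ I`, `p·x ∈ I` and `gcd(m,p) = 1` then `x ∈ I` (Bézout). [folklore] -/
private theorem mem_of_coprime_of_mul_mem (I : Ideal R) {m : ℕ} (hm : Nat.Coprime m p) {x : R}
    (h1 : (m : R) * x ∈ I) (h2 : (p : R) * x ∈ I) : x ∈ I := by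
  obtain ⟨u, v, huv⟩ := (Nat.isCoprime_iff_coprime.mpr hm : IsCoprime (m : ℤ) (p : ℤ))
  have key : x = (u : R) * ((m : R) * x) + (v : R) * ((p : R) * x) := by
    have h := congrArg (fun z : ℤ => (z : R) * x) huv
    simp only [Int.cast_add, Int.cast_mul, Int.cast_natCast, Int.cast_one, one_mul] at h
    calc x = ((u : R) * m + (v : R) * p) * x := h.symm
      _ = _ := by ring
  rw [key]
  exact I.add_mem (I.mul_mem_left _ h1) (I.mul_mem_left _ h2)

/-- Digits: if `⌊s/p^j⌋ ≡ 0 (mod p)` for all `j ≤ f` then `p^{f+1} ∣ s`. [folklore] -/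
private theorem pow_succ_dvd_of_digits_eq_zero {s f : ℕ} (h : ∀ j ≤ f, s / p ^ j % p = 0) : p ^ (f + 1) ∣ s := by
  have key : ∀ k ≤ f + 1, p ^ k ∣ s := by
    intro k
    induction k with
    | zero => intro _; exact ⟨s, by simp⟩
    | succ k ih =>
      intro hk
      obtain ⟨t, ht⟩ := ih (by omega)
      have hpk : 0 < p ^ k := pow_pos hp.out.pos k
      have hmod := h k (by omega)
      rw [ht, Nat.mul_div_cancel_left _ hpk] at hmod
      obtain ⟨u, hu⟩ := Nat.dvd_of_mod_eq_zero hmod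
      exact ⟨u, by rw [ht, hu, pow_succ, mul_assoc]⟩
  exact key (f + 1) le_rfl

/-- Core of the uniqueness argument (Lazard 1955 §III): with `s₀ = p^f`, `p^f ∣ n`, `a_{s₀} ∈ I`, the relations with
`i = p^j` give `a_{p^j} ∈ I` for `j ≤ f` and then `a_s ∈ I` for every `s` having a nonzero base-`p` digit of index `≤ f`.
[cite: Lazard1955, §III (3.6)–(3.8)] -/
theorem cocycleCoeff_mem_of_digit_ne_zero (I : Ideal R) {n f : ℕ} {a : ℕ → R}
    (hpI : ∀ s, 1 ≤ s → s ≤ n - 1 → (p : R) * a s ∈ I)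
    (hrel : ∀ i s, 1 ≤ i → i ≤ s → s ≤ n - 1 → (s.choose i : R) * a s = ((n - i).choose (s - i) : R) * a i)
    (hfn : p ^ f ∣ n) (hfl : p ^ f ≤ n - 1) (h0 : a (p ^ f) ∈ I)
    {s : ℕ} (hs1 : 1 ≤ s) (hs2 : s ≤ n - 1) {j : ℕ} (hj : j ≤ f) (hdig : s / p ^ j % p ≠ 0) : a s ∈ I := by
  -- Step A: `a_{p^j} ∈ I`
  have hpj : 0 < p ^ j := pow_pos hp.out.pos j
  have hpjf : p ^ j ≤ p ^ f := Nat.pow_le_pow_right hp.out.pos hj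
  have hA : a (p ^ j) ∈ I := by
    rcases Nat.eq_or_lt_of_le hj with rfl | hjf
    · exact h0
    · obtain ⟨M, hM⟩ := hfn
      have hM1 : 1 ≤ M := by
        rcases Nat.eq_zero_or_pos M with rfl | h
        · rw [mul_zero] at hM; omega
        · exact h
      obtain ⟨c, hc⟩ : ∃ c, f = j + c := ⟨f - j, by omega⟩
      have hrelA := hrel (p ^ j) (p ^ f) hpj hpjf hfl
      -- the binomial coefficient `C(n - p^j, p^f - p^j) ≡ C(p^c (M-1) + p^c - 1, p^c - 1) ≡ 1 (mod p)`
      have hcop : Nat.Coprime ((n - p ^ j).choose (p ^ f - p ^ j)) p := by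
        have e1 : n - p ^ j = p ^ j * (p ^ c * (M - 1) + (p ^ c - 1)) := by
          have hpc : 1 ≤ p ^ c := Nat.one_le_pow _ _ hp.out.pos
          rw [hM, hc, pow_add]
          zify [hM1, hpc, show p ^ j ≤ p ^ j * p ^ c * M from
            le_trans (Nat.le_mul_of_pos_right _ hpc) (Nat.le_mul_of_pos_right _ hM1)]
          ring
        have e2 : p ^ f - p ^ j = p ^ j * (p ^ c - 1) := by
          have hpc : 1 ≤ p ^ c := Nat.one_le_pow _ _ hp.out.pos
          rw [hc, pow_add]
          zify [hpc, Nat.le_mul_of_pos_right (p ^ j) hpc]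
          ring
        rw [e1, e2]
        have hmod := Choose.choose_pow_mul_pow_mul_modEq_choose_nat (p := p) (k := j)
          (a := p ^ c * (M - 1) + (p ^ c - 1)) (b := p ^ c - 1)
        have hB := coprime_choose_block_pred (p := p) c (M - 1)
        unfold Nat.Coprime at hB ⊢
        rw [Nat.ModEq.gcd_eq hmod]
        exact hB
      refine mem_of_coprime_of_mul_mem I hcop ?_ (hpI _ hpj (by omega))
      rw [← hrelA]
      exact I.mul_mem_left _ h0
  -- Step B: the relation with `i = p^j`
  have hsj : p ^ j ≤ s := by
    by_contra hlt
    rw [not_le] at hlt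
    rw [Nat.div_eq_of_lt hlt, Nat.zero_mod] at hdig
    exact hdig rfl
  have hrelB := hrel (p ^ j) s hpj hsj hs2
  have hcop : Nat.Coprime (s.choose (p ^ j)) p := coprime_choose_prime_pow_of_digit_ne_zero (p := p) hdig
  refine mem_of_coprime_of_mul_mem I hcop ?_ (hpI s hs1 hs2)
  rw [hrelB]
  exact I.mul_mem_left _ hA

/-- **Uniqueness half of Lazard's comparison lemma, modulo an ideal** (Lazard 1955 §III over `𝔽_p`; here for families
killed by `p` modulo `I`).  Let `n ≥ 2` and `a : ℕ → R` satisfy, for `1 ≤ s ≤ n-1`: `p·a_s ∈ I`, the symmetry `a_{n-s} = a_s`,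
and the cocycle relations `C(s,i) a_s = C(n-i,s-i) a_i` (`1 ≤ i ≤ s ≤ n-1`).  If `a_{s₀} ∈ I` for Lazard's index `s₀`, then
`a_s ∈ I` for all `1 ≤ s ≤ n-1`. [cite: Lazard1955, Lemme 3, §III] -/
theorem cocycleCoeff_mem_of_lazardIndex_mem (I : Ideal R) {n : ℕ} (hn : 2 ≤ n) {a : ℕ → R}
    (hpI : ∀ s, 1 ≤ s → s ≤ n - 1 → (p : R) * a s ∈ I)
    (hsymm : ∀ s, 1 ≤ s → s ≤ n - 1 → a (n - s) = a s)
    (hrel : ∀ i s, 1 ≤ i → i ≤ s → s ≤ n - 1 → (s.choose i : R) * a s = ((n - i).choose (s - i) : R) * a i)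
    (h0 : a (lazardIndex p n) ∈ I) : ∀ s, 1 ≤ s → s ≤ n - 1 → a s ∈ I := by
  set e := n.factorization p with he
  have hsl := lazardIndex_le (p := p) hn
  by_cases hpow : n = p ^ e
  · -- `n = p^e`, `s₀ = p^{e-1}`
    have he1 : 1 ≤ e := factorization_pos_of_eq_pow hn hpow
    have hs0 : lazardIndex p n = p ^ (e - 1) := by unfold lazardIndex; rw [if_pos hpow]
    rw [hs0] at h0 hsl
    have hfn : p ^ (e - 1) ∣ n := ⟨p, by rw [← pow_succ, Nat.sub_add_cancel he1]; exact hpow⟩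
    intro s hs1 hs2
    by_cases hdig : ∃ j ≤ e - 1, s / p ^ j % p ≠ 0
    · obtain ⟨j, hj, hd⟩ := hdig
      exact cocycleCoeff_mem_of_digit_ne_zero I hpI hrel hfn hsl h0 hs1 hs2 hj hd
    · push Not at hdig
      have hdvd := pow_succ_dvd_of_digits_eq_zero (p := p) hdig
      rw [Nat.sub_add_cancel he1, ← hpow] at hdvd
      have := Nat.le_of_dvd (by omega) hdvd
      omega
  · -- `n` not a power of `p`, `s₀ = p^e`
    have hs0 : lazardIndex p n = p ^ e := by unfold lazardIndex; rw [if_neg hpow]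
    rw [hs0] at h0 hsl
    have hfn : p ^ e ∣ n := Nat.ordProj_dvd n p
    have hne : ¬ p ^ (e + 1) ∣ n := Nat.pow_succ_factorization_not_dvd (by omega) hp.out
    -- every `s` with a nonzero digit of index `≤ e` is settled; otherwise `p^{e+1} ∣ s`
    have dich : ∀ s, 1 ≤ s → s ≤ n - 1 → a s ∈ I ∨ p ^ (e + 1) ∣ s := by
      intro s hs1 hs2
      by_cases hdig : ∃ j ≤ e, s / p ^ j % p ≠ 0
      · obtain ⟨j, hj, hd⟩ := hdig
        exact Or.inl (cocycleCoeff_mem_of_digit_ne_zero I hpI hrel hfn hsl h0 hs1 hs2 hj hd)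
      · push Not at hdig
        exact Or.inr (pow_succ_dvd_of_digits_eq_zero (p := p) hdig)
    intro s hs1 hs2
    rcases dich s hs1 hs2 with h | h
    · exact h
    · rcases dich (n - s) (by omega) (by omega) with h' | h'
      · rwa [hsymm s hs1 hs2] at h'
      · exfalso
        apply hne
        have : n = s + (n - s) := by omega
        rw [this]
        exact dvd_add h h'

end Uniqueness

/-! ## §4 The comparison lemma over rings in which `p` is nilpotent -/

section Existence

variable {B : Type*} [CommRing B] {p : ℕ} [hp : Fact p.Prime]

omit hp in
/-- A modular inverse of an integer prime to `p`, read in `B`: `m·u = 1 + p·t`. [folklore] -/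
private theorem exists_mul_eq_one_add_of_coprime {m : ℕ} (hm : Nat.Coprime m p) :
    ∃ u t : B, (m : B) * u = 1 + (p : B) * t := by
  obtain ⟨u, v, huv⟩ := (Nat.isCoprime_iff_coprime.mpr hm : IsCoprime (m : ℤ) (p : ℤ))
  refine ⟨(u : B), (-v : ℤ), ?_⟩
  have h := congrArg (fun z : ℤ => (z : B)) huv
  simp only [Int.cast_add, Int.cast_mul, Int.cast_natCast, Int.cast_one] at h
  rw [Int.cast_neg]
  linear_combination h

/-- One step of the `p`-adic filtration: a symmetric cocycle family with values in an ideal `J` is, modulo `J' ⊇ p·J`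
(i.e. `p x ∈ J'` for `x ∈ J`), a multiple of `(b_{n,s})_s`. [cite: Lazard1955, Lemme 3, §III] -/
theorem exists_sub_lazardCoeff_mul_mem (J J' : Ideal B) (hJ : ∀ x ∈ J, (p : B) * x ∈ J') {n : ℕ} (hn : 2 ≤ n)
    {a : ℕ → B} (haJ : ∀ s, 1 ≤ s → s ≤ n - 1 → a s ∈ J)
    (hsymm : ∀ s, 1 ≤ s → s ≤ n - 1 → a (n - s) = a s)
    (hrel : ∀ i s, 1 ≤ i → i ≤ s → s ≤ n - 1 → (s.choose i : B) * a s = ((n - i).choose (s - i) : B) * a i) :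
    ∃ c : B, ∀ s, 1 ≤ s → s ≤ n - 1 → a s - (lazardCoeff n s : B) * c ∈ J' := by
  set s₀ := lazardIndex p n with hs₀
  obtain ⟨u, t, hut⟩ := exists_mul_eq_one_add_of_coprime (B := B)
    (Nat.Coprime.symm ((Nat.Prime.coprime_iff_not_dvd hp.out).mpr (not_dvd_lazardCoeff_lazardIndex (p := p) hn)))
  rw [← hs₀] at hut
  refine ⟨u * a s₀, ?_⟩
  -- the corrected family `a' s = a s - b_s · (u a_{s₀})` is again a symmetric cocycle family, killed by `p` mod `J'`
  set a' : ℕ → B := fun s => a s - (lazardCoeff n s : B) * (u * a s₀) with ha'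
  have h1 := one_le_lazardIndex (p := p) n
  have h2 := lazardIndex_le (p := p) hn
  have hpJ' : ∀ s, 1 ≤ s → s ≤ n - 1 → (p : B) * a' s ∈ J' := by
    intro s hs1 hs2
    simp only [ha', mul_sub]
    refine J'.sub_mem (hJ _ (haJ s hs1 hs2)) ?_
    rw [show (p : B) * ((lazardCoeff n s : B) * (u * a s₀)) = (lazardCoeff n s : B) * u * ((p : B) * a s₀) by ring]
    exact J'.mul_mem_left _ (hJ _ (haJ _ h1 h2))
  have hsymm' : ∀ s, 1 ≤ s → s ≤ n - 1 → a' (n - s) = a' s := by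
    intro s hs1 hs2
    simp only [ha']
    rw [hsymm s hs1 hs2, lazardCoeff_symm (by omega)]
  have hrel' : ∀ i s, 1 ≤ i → i ≤ s → s ≤ n - 1 →
      (s.choose i : B) * a' s = ((n - i).choose (s - i) : B) * a' i := by
    intro i s hi his hs
    simp only [ha', mul_sub]
    rw [hrel i s hi his hs]
    have hcast : (s.choose i : B) * (lazardCoeff n s : B) = ((n - i).choose (s - i) : B) * (lazardCoeff n i : B) := by
      have h := congrArg (Nat.cast : ℕ → B) (choose_mul_lazardCoeff (n := n) hi his hs)
      simpa only [Nat.cast_mul] using h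
    rw [← mul_assoc, hcast, mul_assoc]
  have h0' : a' s₀ ∈ J' := by
    simp only [ha']
    rw [show a s₀ - (lazardCoeff n s₀ : B) * (u * a s₀) = -(t * ((p : B) * a s₀)) by linear_combination (-(a s₀)) * hut]
    exact J'.neg_mem (J'.mul_mem_left _ (hJ _ (haJ _ h1 h2)))
  intro s hs1 hs2
  exact cocycleCoeff_mem_of_lazardIndex_mem J' hn hpJ' hsymm' hrel' h0' s hs1 hs2

/-- **Lazard's comparison lemma (symmetric 2-cocycle lemma) over a ring in which `p` is nilpotent, coefficient form.**
Let `p` be nilpotent in `B`, `n ≥ 2`, and let `a : ℕ → B` satisfy the symmetry `a_{n-s} = a_s` and the cocycle relations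
`C(s,i)·a_s = C(n-i, s-i)·a_i` (`1 ≤ i ≤ s ≤ n-1`) — i.e. `Σ_{0<s<n} a_s X^s Y^{n-s}` is a symmetric 2-cocycle.  Then there is
`c ∈ B` with `a_s = b_{n,s}·c` for all `1 ≤ s ≤ n-1`, where `Σ b_{n,s} X^s Y^{n-s} = C_n(X,Y) = d_n⁻¹((X+Y)^n - X^n - Y^n)`.
(Lazard proves this over every ring; the `p`-adic filtration argument given here covers the rings of the `p`-typical theory.)
[cite: Lazard1955, Lemme 3] -/
theorem exists_eq_lazardCoeff_mul_of_isNilpotent (hpB : IsNilpotent (p : B)) {n : ℕ} (hn : 2 ≤ n) {a : ℕ → B}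
    (hsymm : ∀ s, 1 ≤ s → s ≤ n - 1 → a (n - s) = a s)
    (hrel : ∀ i s, 1 ≤ i → i ≤ s → s ≤ n - 1 → (s.choose i : B) * a s = ((n - i).choose (s - i) : B) * a i) :
    ∃ c : B, ∀ s, 1 ≤ s → s ≤ n - 1 → a s = (lazardCoeff n s : B) * c := by
  obtain ⟨N, hN⟩ := hpB
  -- induction over the filtration `Ideal.span {p^k}`
  have key : ∀ k : ℕ, ∃ c : B, ∀ s, 1 ≤ s → s ≤ n - 1 → a s - (lazardCoeff n s : B) * c ∈ Ideal.span {(p : B) ^ k} := by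
    intro k
    induction k with
    | zero => exact ⟨0, fun s _ _ => by rw [pow_zero, Ideal.span_singleton_one]; exact Submodule.mem_top⟩
    | succ k ih =>
      obtain ⟨c, hc⟩ := ih
      have hJ : ∀ x ∈ Ideal.span {(p : B) ^ k}, (p : B) * x ∈ Ideal.span {(p : B) ^ (k + 1)} := by
        intro x hx
        obtain ⟨y, rfl⟩ := Ideal.mem_span_singleton'.mp hx
        exact Ideal.mem_span_singleton'.mpr ⟨y, by rw [pow_succ]; ring⟩
      have hsymm' : ∀ s, 1 ≤ s → s ≤ n - 1 →
          a (n - s) - (lazardCoeff n (n - s) : B) * c = a s - (lazardCoeff n s : B) * c := by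
        intro s hs1 hs2; rw [hsymm s hs1 hs2, lazardCoeff_symm (by omega)]
      have hrel' : ∀ i s, 1 ≤ i → i ≤ s → s ≤ n - 1 →
          (s.choose i : B) * (a s - (lazardCoeff n s : B) * c) =
            ((n - i).choose (s - i) : B) * (a i - (lazardCoeff n i : B) * c) := by
        intro i s hi his hs
        rw [mul_sub, mul_sub, hrel i s hi his hs]
        have hcast : (s.choose i : B) * (lazardCoeff n s : B) = ((n - i).choose (s - i) : B) * (lazardCoeff n i : B) := by
          have h := congrArg (Nat.cast : ℕ → B) (choose_mul_lazardCoeff (n := n) hi his hs)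
          simpa only [Nat.cast_mul] using h
        rw [← mul_assoc, hcast, mul_assoc]
      obtain ⟨c', hc'⟩ := exists_sub_lazardCoeff_mul_mem (p := p) _ _ hJ hn hc hsymm' hrel'
      exact ⟨c + c', fun s hs1 hs2 => by
        have := hc' s hs1 hs2
        rwa [sub_sub, ← mul_add] at this⟩
  obtain ⟨c, hc⟩ := key N
  refine ⟨c, fun s hs1 hs2 => ?_⟩
  have h := hc s hs1 hs2
  rw [hN, Ideal.span_singleton_zero, Ideal.mem_bot, sub_eq_zero] at h
  exact h

end Existence

end Literature.RingTheory.FormalGroups
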